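import Literature.Computability.AlgebraicComplexity.Kron444HullCheck
import HarnessLib

/-!
# `Kron(4,4,4) ⊆ conv(328 vertices)`: certificate checks, part 11/14

Proofs file (computations only): the node checks of `Kron444HullCheck.lean` for the chunks
143 … 154 of the certificate, each decided by the kernel (`decide +kernel`; `maxHeartbeats 0`:
a chunk is ≈ 10⁵–10⁶ kernel reductions). Assembled in `Kron444Hull.lean`. [folklore]
-/

set_option Elab.async false

namespace Literature.Computability.AlgebraicComplexity.Kron444Hull

/-- Nodes `3575 … 3599` of the certificate (chunk `143`) pass `checkNodeRec`. [folklore] -/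
theorem checkChunk_143 : checkChunk 143 25 = true := by
  set_option maxHeartbeats 0 in decide +kernel

/-- Nodes `3600 … 3624` of the certificate (chunk `144`) pass `checkNodeRec`. [folklore] -/
theorem checkChunk_144 : checkChunk 144 25 = true := by
  set_option maxHeartbeats 0 in decide +kernel

/-- Nodes `3625 … 3649` of the certificate (chunk `145`) pass `checkNodeRec`. [folklore] -/
theorem checkChunk_145 : checkChunk 145 25 = true := by
  set_option maxHeartbeats 0 in decide +kernel

/-- Nodes `3650 … 3674` of the certificate (chunk `146`) pass `checkNodeRec`. [folklore] -/
theorem checkChunk_146 : checkChunk 146 25 = true := by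
  set_option maxHeartbeats 0 in decide +kernel

/-- Nodes `3675 … 3699` of the certificate (chunk `147`) pass `checkNodeRec`. [folklore] -/
theorem checkChunk_147 : checkChunk 147 25 = true := by
  set_option maxHeartbeats 0 in decide +kernel

/-- Nodes `3700 … 3724` of the certificate (chunk `148`) pass `checkNodeRec`. [folklore] -/
theorem checkChunk_148 : checkChunk 148 25 = true := by
  set_option maxHeartbeats 0 in decide +kernel

/-- Nodes `3725 … 3749` of the certificate (chunk `149`) pass `checkNodeRec`. [folklore] -/
theorem checkChunk_149 : checkChunk 149 25 = true := by
  set_option maxHeartbeats 0 in decide +kernel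

/-- Nodes `3750 … 3774` of the certificate (chunk `150`) pass `checkNodeRec`. [folklore] -/
theorem checkChunk_150 : checkChunk 150 25 = true := by
  set_option maxHeartbeats 0 in decide +kernel

/-- Nodes `3775 … 3799` of the certificate (chunk `151`) pass `checkNodeRec`. [folklore] -/
theorem checkChunk_151 : checkChunk 151 25 = true := by
  set_option maxHeartbeats 0 in decide +kernel

/-- Nodes `3800 … 3824` of the certificate (chunk `152`) pass `checkNodeRec`. [folklore] -/
theorem checkChunk_152 : checkChunk 152 25 = true := by
  set_option maxHeartbeats 0 in decide +kernel

/-- Nodes `3825 … 3849` of the certificate (chunk `153`) pass `checkNodeRec`. [folklore] -/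
theorem checkChunk_153 : checkChunk 153 25 = true := by
  set_option maxHeartbeats 0 in decide +kernel

/-- Nodes `3850 … 3874` of the certificate (chunk `154`) pass `checkNodeRec`. [folklore] -/
theorem checkChunk_154 : checkChunk 154 25 = true := by
  set_option maxHeartbeats 0 in decide +kernel

end Literature.Computability.AlgebraicComplexity.Kron444Hull
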